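import Summits.Ventures.GridStability.Lyapunov.StructurePreservingBlockEnergy
import HarnessLib

/-!
# Signed couplings II — the closed-form ROWS are valid: concavity of cosine averages on the window,
# endpoint rows ⇒ box minorants, block facts (i)′ (ii)′ (iii)′ from closed-form data alone

Venture GRIDFUSION, G2-SCALE cell; card «idea-3 (cycle 4) / signed-coupling-triangle-absorption»
(HOME/IDEAS-G2.md § l.675; crit-1 GRADE PASS · NEW-COMBINATION, STATUS 2026-08-28T20:54:27Z); the planner's scratch
proof `HOME/idea-3/c4/BlockRoaW.lean` (sha16 ce7574047d5005c1, 2 175 lines, farm rc 0 / 0 sorry / standard axioms,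
crit-1 g2 independent check STATUS l.10676) filed in content by the cell's Lean-lane seat gridfusion-sos-5 (g11), split
into tree modules `StructurePreservingBlock{Energy,Rows,Cover,Region,Roa,Level,Toys}`; namespace renamed from
`…Ideas.TriangleAbsorption.Roa` to `…Lyapunov.StructurePreserving.SignedBlock`. 0 kit, 0 facts.
THREE COLUMNS: theorems about the MODELLED lossless structure-preserving model MV-3 with SIGNED couplings (negative
branch reactances: three-winding-transformer star equivalents, series capacitors); nothing here is a certificate for
any benchmark and nothing here certifies a real grid.

WHAT THIS MODULE SAYS (card K2(a); `Sketch.lean` §8).  On the window `|α| + ρ ≤ π/2` every swept angle `α + t x`,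
`t ∈ [0,1]`, `|x| ≤ ρ`, stays in `[−π/2, π/2]` where cosine is concave, so the weighted cosine averages
`∫₀¹ w(t) cos(α + t x) dt` (`w ≥ 0`) are CONCAVE in `x` on `[−ρ, ρ]` and bounded below by their endpoint values.
Taylor with integral remainder writes `U(α; x) = x²·∫₀¹(1−t)cos(α+tx)dt` and `sin(α+x) − sin α = x·∫₀¹cos(α+tx)dt`;
hence the chord-curvature row `m x² ≤ β U(α; x)` and the slope row `q x² ≤ β x (sin(α+x) − sin α)` hold on the whole
box as soon as they hold at the two ENDPOINTS `x = ±ρ` — O(1) closed-form numbers per leg (the `row_m` / `row_q`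
fields of a block cover, next module).

* `cosAvg`, `swept_mem`, `cosAvg_concaveOn`, `min_endpoints_le`, `sq_mul_cosAvg`, `mul_cosAvg_one`;
* `row_m_valid`, `row_q_valid` (endpoint rows ⇒ box rows);
* `blockEnergy_nonneg_of_endpointRows` (i)′, `blockEnergy_face_of_endpointRows` / `blockEnergy_face₂_of_endpointRows`
  (ii)′, `blockPairing_pos_of_endpointRows` / `blockPairing_nonneg_of_endpointRows` (iii)′.
-/

noncomputable section

open Set Filter Topology Real Finset
open Summit.Ventures.GridStability.Models.StructurePreserving
open Summit.Ventures.GridStability.Models.StructurePreserving.Params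

namespace Summit.Ventures.GridStability.Lyapunov.StructurePreserving.SignedBlock

/-! ### §8. K2(a): cosine averages are concave on the window; endpoint rows suffice -/

/-- Weighted cosine average over the swept angle: `∫₀¹ w(t)·cos(α + t·x) dt`. -/
def cosAvg (w : ℝ → ℝ) (α x : ℝ) : ℝ := ∫ t in (0:ℝ)..1, w t * Real.cos (α + t * x)

/-- On the window `|α| + ρ ≤ π/2` every swept angle stays in `[−π/2, π/2]`. -/
theorem swept_mem {α ρ : ℝ} (hαρ : |α| + ρ ≤ π / 2) {z : ℝ} (hz : z ∈ Icc (-ρ) ρ)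
    {t : ℝ} (ht : t ∈ Icc (0:ℝ) 1) : α + t * z ∈ Icc (-(π / 2)) (π / 2) := by
  have hz' : |z| ≤ ρ := abs_le.mpr ⟨by linarith [hz.1], hz.2⟩
  have htz : |t * z| ≤ ρ := by
    rw [abs_mul, abs_of_nonneg ht.1]
    calc t * |z| ≤ 1 * |z| := by gcongr; exact ht.2
      _ ≤ ρ := by simpa using hz'
  have hsum : |α + t * z| ≤ π / 2 := (abs_add_le _ _).trans (by linarith)
  exact ⟨(abs_le.mp hsum).1, (abs_le.mp hsum).2⟩

/-- **Concavity of cosine averages on the window** (nonnegative continuous weight). -/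
theorem cosAvg_concaveOn {w : ℝ → ℝ} (hw : Continuous w) (hw0 : ∀ t ∈ Icc (0:ℝ) 1, 0 ≤ w t)
    {α ρ : ℝ} (hαρ : |α| + ρ ≤ π / 2) : ConcaveOn ℝ (Icc (-ρ) ρ) (cosAvg w α) := by
  refine ⟨convex_Icc _ _, ?_⟩
  intro x hx y hy a b ha hb hab
  have hpt : ∀ t ∈ Icc (0:ℝ) 1,
      a * (w t * Real.cos (α + t * x)) + b * (w t * Real.cos (α + t * y))
        ≤ w t * Real.cos (α + t * (a * x + b * y)) := by
    intro t ht
    have hc := strictConcaveOn_cos_Icc.concaveOn.2 (swept_mem hαρ hx ht) (swept_mem hαρ hy ht)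
      ha hb hab
    simp only [smul_eq_mul] at hc
    have heq : a * (α + t * x) + b * (α + t * y) = α + t * (a * x + b * y) := by
      have h1 : a * (α + t * x) + b * (α + t * y) = α * (a + b) + t * (a * x + b * y) := by ring
      rw [h1, hab]; ring
    rw [heq] at hc
    have := mul_le_mul_of_nonneg_left hc (hw0 t ht)
    linarith [this]
  have hi1 : IntervalIntegrable (fun t => a * (w t * Real.cos (α + t * x)) + b * (w t * Real.cos (α + t * y)))
      MeasureTheory.volume 0 1 := by
    apply Continuous.intervalIntegrable; fun_prop
  have hi2 : IntervalIntegrable (fun t => w t * Real.cos (α + t * (a * x + b * y)))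
      MeasureTheory.volume 0 1 := by
    apply Continuous.intervalIntegrable; fun_prop
  have hix : IntervalIntegrable (fun t => w t * Real.cos (α + t * x)) MeasureTheory.volume 0 1 := by
    apply Continuous.intervalIntegrable; fun_prop
  have hiy : IntervalIntegrable (fun t => w t * Real.cos (α + t * y)) MeasureTheory.volume 0 1 := by
    apply Continuous.intervalIntegrable; fun_prop
  have hsplit : a • cosAvg w α x + b • cosAvg w α y
      = ∫ t in (0:ℝ)..1, (a * (w t * Real.cos (α + t * x)) + b * (w t * Real.cos (α + t * y))) := by
    simp only [cosAvg, smul_eq_mul]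
    rw [intervalIntegral.integral_add (hix.const_mul a) (hiy.const_mul b),
      intervalIntegral.integral_const_mul, intervalIntegral.integral_const_mul]
  rw [hsplit]
  simpa only [cosAvg, smul_eq_mul] using
    intervalIntegral.integral_mono_on zero_le_one hi1 hi2 hpt

/-- A concave function on `[−ρ, ρ]` is bounded below by its smaller endpoint value. -/
theorem min_endpoints_le {f : ℝ → ℝ} {ρ : ℝ} (hf : ConcaveOn ℝ (Icc (-ρ) ρ) f) {x : ℝ}
    (hx : x ∈ Icc (-ρ) ρ) : min (f (-ρ)) (f ρ) ≤ f x := by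
  have hρ : -ρ ≤ ρ := le_trans hx.1 hx.2
  exact hf.ge_on_segment (left_mem_Icc.mpr hρ) (right_mem_Icc.mpr hρ) (by rwa [segment_eq_Icc hρ])

/-- **Taylor with integral remainder, curvature form**: `x²·∫₀¹(1−t)cos(α + t x) dt = U(α; x)`. -/
theorem sq_mul_cosAvg (α x : ℝ) : x ^ 2 * cosAvg (fun t => 1 - t) α x = U α x := by
  unfold cosAvg U
  rw [← intervalIntegral.integral_const_mul]
  have hG : ∀ t, HasDerivAt (fun t => x * (1 - t) * Real.sin (α + t * x) - Real.cos (α + t * x))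
      (x ^ 2 * ((1 - t) * Real.cos (α + t * x))) t := by
    intro t
    have h1 : HasDerivAt (fun t => α + t * x) x t := by
      simpa using ((hasDerivAt_id t).mul_const x).const_add α
    have h2 : HasDerivAt (fun t => Real.sin (α + t * x)) (Real.cos (α + t * x) * x) t := h1.sin
    have h3 : HasDerivAt (fun t => Real.cos (α + t * x)) (-Real.sin (α + t * x) * x) t := h1.cos
    have h4 : HasDerivAt (fun t => x * (1 - t)) (x * (-1)) t := by
      simpa using ((hasDerivAt_id t).const_sub 1).const_mul x
    exact ((h4.mul h2).sub h3).congr_deriv (by ring)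
  rw [intervalIntegral.integral_eq_sub_of_hasDerivAt (fun t _ => hG t)
    (by apply Continuous.intervalIntegrable; fun_prop)]
  simp only [sub_self, mul_zero, zero_mul, one_mul, mul_one, sub_zero, add_zero, zero_sub]
  ring

/-- **Slope form**: `x·∫₀¹ cos(α + t x) dt = sin(α + x) − sin α`. -/
theorem mul_cosAvg_one (α x : ℝ) : x * cosAvg (fun _ => 1) α x = Real.sin (α + x) - Real.sin α := by
  unfold cosAvg
  rw [← intervalIntegral.integral_const_mul]
  have hG : ∀ t, HasDerivAt (fun t => Real.sin (α + t * x)) (x * (1 * Real.cos (α + t * x))) t := by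
    intro t
    have h1 : HasDerivAt (fun t => α + t * x) x t := by
      simpa using ((hasDerivAt_id t).mul_const x).const_add α
    exact h1.sin.congr_deriv (by ring)
  rw [intervalIntegral.integral_eq_sub_of_hasDerivAt (fun t _ => hG t)
    (by apply Continuous.intervalIntegrable; fun_prop)]
  simp

/-- **K2(a), curvature row VALID**: endpoint rows `mρ² ≤ β·U(α; ±ρ)` on the window `|α| + ρ ≤ π/2`
give the quadratic minorant `m x² ≤ β U(α; x)` on the whole box. -/
theorem row_m_valid {β α ρ m : ℝ} (hβ : 0 < β) (hρ : 0 < ρ) (hαρ : |α| + ρ ≤ π / 2)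
    (hp : m * ρ ^ 2 ≤ β * U α ρ) (hm : m * ρ ^ 2 ≤ β * U α (-ρ)) :
    ∀ x, |x| ≤ ρ → m * x ^ 2 ≤ β * U α x := by
  intro x hx
  set R := cosAvg (fun t => 1 - t) α with hR
  have hconc : ConcaveOn ℝ (Icc (-ρ) ρ) R :=
    cosAvg_concaveOn (by fun_prop) (fun t ht => by linarith [ht.2]) hαρ
  have hxI : x ∈ Icc (-ρ) ρ := ⟨(abs_le.mp hx).1, (abs_le.mp hx).2⟩
  have hmin := min_endpoints_le hconc hxI
  have hUx : U α x = x ^ 2 * R x := (sq_mul_cosAvg α x).symm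
  have hUp : U α ρ = ρ ^ 2 * R ρ := (sq_mul_cosAvg α ρ).symm
  have hUm : U α (-ρ) = ρ ^ 2 * R (-ρ) := by rw [← sq_mul_cosAvg α (-ρ)]; ring
  have hρ2 : 0 < ρ ^ 2 := by positivity
  have h1 : m ≤ β * R ρ := by
    have : m * ρ ^ 2 ≤ (β * R ρ) * ρ ^ 2 := by rw [hUp] at hp; linarith
    exact le_of_mul_le_mul_right this hρ2
  have h2 : m ≤ β * R (-ρ) := by
    have : m * ρ ^ 2 ≤ (β * R (-ρ)) * ρ ^ 2 := by rw [hUm] at hm; linarith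
    exact le_of_mul_le_mul_right this hρ2
  have h3 : m ≤ β * R x := by
    rcases min_choice (R (-ρ)) (R ρ) with h | h
    · rw [h] at hmin; nlinarith
    · rw [h] at hmin; nlinarith
  have hx2 : 0 ≤ x ^ 2 := by positivity
  calc m * x ^ 2 ≤ (β * R x) * x ^ 2 := mul_le_mul_of_nonneg_right h3 hx2
    _ = β * U α x := by rw [hUx]; ring

/-- **K2(a), slope (pairing) row VALID**: endpoint rows `qρ ≤ β(sin(α+ρ) − sin α)`,
`qρ ≤ β(sin α − sin(α−ρ))` on the window give `q x² ≤ β·x(sin(α+x) − sin α)` on the whole box. -/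
theorem row_q_valid {β α ρ q : ℝ} (hβ : 0 < β) (hρ : 0 < ρ) (hαρ : |α| + ρ ≤ π / 2)
    (hp : q * ρ ≤ β * (Real.sin (α + ρ) - Real.sin α))
    (hm : q * ρ ≤ β * (Real.sin α - Real.sin (α - ρ))) :
    ∀ x, |x| ≤ ρ → q * x ^ 2 ≤ β * P α x := by
  intro x hx
  set Q := cosAvg (fun _ => 1) α with hQ
  have hconc : ConcaveOn ℝ (Icc (-ρ) ρ) Q :=
    cosAvg_concaveOn continuous_const (fun t _ => zero_le_one) hαρ
  have hxI : x ∈ Icc (-ρ) ρ := ⟨(abs_le.mp hx).1, (abs_le.mp hx).2⟩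
  have hmin := min_endpoints_le hconc hxI
  have hPx : P α x = x ^ 2 * Q x := by
    unfold P; rw [← mul_cosAvg_one α x]; ring
  have hQp : Real.sin (α + ρ) - Real.sin α = ρ * Q ρ := (mul_cosAvg_one α ρ).symm
  have hQm : Real.sin α - Real.sin (α - ρ) = ρ * Q (-ρ) := by
    have := mul_cosAvg_one α (-ρ)
    rw [← sub_eq_add_neg] at this
    linarith
  have h1 : q ≤ β * Q ρ := by
    have : q * ρ ≤ (β * Q ρ) * ρ := by rw [hQp] at hp; linarith
    exact le_of_mul_le_mul_right this hρ
  have h2 : q ≤ β * Q (-ρ) := by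
    have : q * ρ ≤ (β * Q (-ρ)) * ρ := by rw [hQm] at hm; linarith
    exact le_of_mul_le_mul_right this hρ
  have h3 : q ≤ β * Q x := by
    rcases min_choice (Q (-ρ)) (Q ρ) with h | h
    · rw [h] at hmin; nlinarith
    · rw [h] at hmin; nlinarith
  have hx2 : 0 ≤ x ^ 2 := by positivity
  calc q * x ^ 2 ≤ (β * Q x) * x ^ 2 := mul_le_mul_of_nonneg_right h3 hx2
    _ = β * P α x := by rw [hPx]; ring


/-- (i)′ from CLOSED-FORM DATA ONLY: window, endpoint curvature rows, weak harmonic row ⇒ `W_K ≥ 0` on the box. -/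
theorem blockEnergy_nonneg_of_endpointRows {β₁ β₂ γ a₁ a₂ a₃ m₁ m₂ ρ : ℝ} (hγ : 0 ≤ γ)
    (hβ₁ : 0 < β₁) (hβ₂ : 0 < β₂) (hρ : 0 < ρ)
    (hw₁ : |a₁| + ρ ≤ π / 2) (hw₂ : |a₂| + ρ ≤ π / 2)
    (e₁ : m₁ * ρ ^ 2 ≤ β₁ * U a₁ ρ) (e₁' : m₁ * ρ ^ 2 ≤ β₁ * U a₁ (-ρ))
    (e₂ : m₂ * ρ ^ 2 ≤ β₂ * U a₂ ρ) (e₂' : m₂ * ρ ^ 2 ≤ β₂ * U a₂ (-ρ))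
    (h₁ : γ / 2 ≤ m₁) (h₂ : γ / 2 ≤ m₂) (hrow : γ / 2 * (m₁ + m₂) ≤ m₁ * m₂)
    {x₁ x₂ : ℝ} (hx₁ : |x₁| ≤ ρ) (hx₂ : |x₂| ≤ ρ) :
    0 ≤ blockEnergy β₁ β₂ γ a₁ a₂ a₃ x₁ x₂ :=
  blockEnergy_nonneg hγ h₁ h₂ hrow (row_m_valid hβ₁ hρ hw₁ e₁ e₁') (row_m_valid hβ₂ hρ hw₂ e₂ e₂')
    (fun y => U_le_half_sq a₃ y) hx₁ hx₂

/-- (ii)′ from CLOSED-FORM DATA ONLY: on the tight faces `x₁ = ±ρ` the block energy is at least the face value. -/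
theorem blockEnergy_face_of_endpointRows {β₁ β₂ γ a₁ a₂ a₃ m₁ m₂ ρ : ℝ} (hγ : 0 ≤ γ)
    (hβ₁ : 0 < β₁) (hβ₂ : 0 < β₂) (hρ : 0 < ρ)
    (hw₁ : |a₁| + ρ ≤ π / 2) (hw₂ : |a₂| + ρ ≤ π / 2)
    (e₁ : m₁ * ρ ^ 2 ≤ β₁ * U a₁ ρ) (e₁' : m₁ * ρ ^ 2 ≤ β₁ * U a₁ (-ρ))
    (e₂ : m₂ * ρ ^ 2 ≤ β₂ * U a₂ ρ) (e₂' : m₂ * ρ ^ 2 ≤ β₂ * U a₂ (-ρ))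
    (h₂ : γ / 2 < m₂)
    {x₂ : ℝ} (hx₂ : |x₂| ≤ ρ) :
    ρ ^ 2 * (m₁ - γ * m₂ / (2 * m₂ - γ)) ≤ blockEnergy β₁ β₂ γ a₁ a₂ a₃ ρ x₂ ∧
    ρ ^ 2 * (m₁ - γ * m₂ / (2 * m₂ - γ)) ≤ blockEnergy β₁ β₂ γ a₁ a₂ a₃ (-ρ) x₂ :=
  blockEnergy_face hγ hρ.le h₂ (row_m_valid hβ₁ hρ hw₁ e₁ e₁') (row_m_valid hβ₂ hρ hw₂ e₂ e₂')
    (fun y => U_le_half_sq a₃ y) hx₂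

/-- (iii)′ from CLOSED-FORM DATA ONLY: window, endpoint slope rows, strict harmonic row ⇒ block strict sector. -/
theorem blockPairing_pos_of_endpointRows {β₁ β₂ γ a₁ a₂ a₃ q₁ q₂ ρ : ℝ} (hγ : 0 ≤ γ)
    (hβ₁ : 0 < β₁) (hβ₂ : 0 < β₂) (hρ : 0 < ρ)
    (hw₁ : |a₁| + ρ ≤ π / 2) (hw₂ : |a₂| + ρ ≤ π / 2)
    (e₁ : q₁ * ρ ≤ β₁ * (Real.sin (a₁ + ρ) - Real.sin a₁)) (e₁' : q₁ * ρ ≤ β₁ * (Real.sin a₁ - Real.sin (a₁ - ρ)))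
    (e₂ : q₂ * ρ ≤ β₂ * (Real.sin (a₂ + ρ) - Real.sin a₂)) (e₂' : q₂ * ρ ≤ β₂ * (Real.sin a₂ - Real.sin (a₂ - ρ)))
    (h₁ : γ < q₁) (h₂ : γ < q₂) (hrow : γ * (q₁ + q₂) < q₁ * q₂)
    {x₁ x₂ : ℝ} (hx₁ : |x₁| ≤ ρ) (hx₂ : |x₂| ≤ ρ) (hx : x₁ ≠ 0 ∨ x₂ ≠ 0) :
    0 < blockPairing β₁ β₂ γ a₁ a₂ a₃ x₁ x₂ :=
  blockPairing_pos hγ h₁ h₂ hrow (row_q_valid hβ₁ hρ hw₁ e₁ e₁') (row_q_valid hβ₂ hρ hw₂ e₂ e₂') hx₁ hx₂ hx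


/-- The `x₂`-faces of the box (the face lemma with the two legs' roles exchanged). -/
theorem blockEnergy_face₂_of_endpointRows {β₁ β₂ γ a₁ a₂ a₃ m₁ m₂ ρ : ℝ} (hγ : 0 ≤ γ)
    (hβ₁ : 0 < β₁) (hβ₂ : 0 < β₂) (hρ : 0 < ρ)
    (hw₁ : |a₁| + ρ ≤ π / 2) (hw₂ : |a₂| + ρ ≤ π / 2)
    (e₁ : m₁ * ρ ^ 2 ≤ β₁ * U a₁ ρ) (e₁' : m₁ * ρ ^ 2 ≤ β₁ * U a₁ (-ρ))
    (e₂ : m₂ * ρ ^ 2 ≤ β₂ * U a₂ ρ) (e₂' : m₂ * ρ ^ 2 ≤ β₂ * U a₂ (-ρ))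
    (h₁ : γ / 2 < m₁)
    {x₁ : ℝ} (hx₁ : |x₁| ≤ ρ) :
    ρ ^ 2 * (m₂ - γ * m₁ / (2 * m₁ - γ)) ≤ blockEnergy β₁ β₂ γ a₁ a₂ a₃ x₁ ρ ∧
    ρ ^ 2 * (m₂ - γ * m₁ / (2 * m₁ - γ)) ≤ blockEnergy β₁ β₂ γ a₁ a₂ a₃ x₁ (-ρ) := by
  have row₁ := row_m_valid hβ₁ hρ hw₁ e₁ e₁'
  have row₂ := row_m_valid hβ₂ hρ hw₂ e₂ e₂'
  have hρ' : |ρ| ≤ ρ := by rw [abs_of_nonneg hρ.le]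
  have hρ'' : |-ρ| ≤ ρ := by rw [abs_neg, abs_of_nonneg hρ.le]
  obtain ⟨hf₁, hf₂⟩ := face_le_quadW (m₁ := m₂) h₁ ρ x₁
  rw [face_formula h₁] at hf₁ hf₂
  have hsym : ∀ y₁ y₂, quadW m₂ m₁ (γ / 2) y₂ y₁ = quadW m₁ m₂ (γ / 2) y₁ y₂ := fun y₁ y₂ => by
    unfold quadW; ring
  rw [hsym] at hf₁ hf₂
  exact ⟨hf₁.trans (blockEnergy_ge_quadW hγ row₁ row₂ (fun y => U_le_half_sq a₃ y) hx₁ hρ'),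
    hf₂.trans (blockEnergy_ge_quadW hγ row₁ row₂ (fun y => U_le_half_sq a₃ y) hx₁ hρ'')⟩

/-- The block pairing is `≥ 0` on the closed box (strictly positive off `x = 0`). -/
theorem blockPairing_nonneg_of_endpointRows {β₁ β₂ γ a₁ a₂ a₃ q₁ q₂ ρ : ℝ} (hγ : 0 ≤ γ)
    (hβ₁ : 0 < β₁) (hβ₂ : 0 < β₂) (hρ : 0 < ρ)
    (hw₁ : |a₁| + ρ ≤ π / 2) (hw₂ : |a₂| + ρ ≤ π / 2)
    (e₁ : q₁ * ρ ≤ β₁ * (Real.sin (a₁ + ρ) - Real.sin a₁)) (e₁' : q₁ * ρ ≤ β₁ * (Real.sin a₁ - Real.sin (a₁ - ρ)))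
    (e₂ : q₂ * ρ ≤ β₂ * (Real.sin (a₂ + ρ) - Real.sin a₂)) (e₂' : q₂ * ρ ≤ β₂ * (Real.sin a₂ - Real.sin (a₂ - ρ)))
    (h₁ : γ < q₁) (h₂ : γ < q₂) (hrow : γ * (q₁ + q₂) < q₁ * q₂)
    {x₁ x₂ : ℝ} (hx₁ : |x₁| ≤ ρ) (hx₂ : |x₂| ≤ ρ) :
    0 ≤ blockPairing β₁ β₂ γ a₁ a₂ a₃ x₁ x₂ := by
  by_cases hx : x₁ ≠ 0 ∨ x₂ ≠ 0
  · exact (blockPairing_pos_of_endpointRows hγ hβ₁ hβ₂ hρ hw₁ hw₂ e₁ e₁' e₂ e₂' h₁ h₂ hrow hx₁ hx₂ hx).le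
  · push Not at hx
    obtain ⟨h1, h2⟩ := hx
    subst h1; subst h2
    simp [blockPairing, P]


end Summit.Ventures.GridStability.Lyapunov.StructurePreserving.SignedBlock

end
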